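import Literature.MathematicalPhysics.QuantumFieldTheory.Balaban1983to89.B6Repr2129

/-!
# `Balaban1983to89.B6GaussianCovariance` — T. Bałaban, *Propagators and renormalization transformations for lattice
# gauge theories. II*, Commun. Math. Phys. **96** (1984) 223–250 [Balaban1984PropagatorsII]: *"a covariance of this
# Gaussian integral"* ((2.25) p. 226, (2.106)/(2.110) p. 242, (2.115) p. 243, (2.119)/p. 246) EXISTS, is UNIQUE and
# SYMMETRIC — the presupposition of the constrained-Gaussian identities of Sect. A–C, PROVED in their typed convention

statement-level skeleton of published theorems with citation tags; proofs where landed; nothing here is a claim about the Yang–Mills mass gap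

PDF held: `paper:balaban1984-cmp96-propagators-rt-ii` (journal page = PDF page + 222); pp. 226–227, 242–243, 246, 248
read AS IMAGES on the ×2 renders `run/shared/lean/pub/pub-balaban/b2b-balaban-ref1/pages/1984-cmp96-propagators-rt-II/
…-p004, -p005, -p020, -p021, -p024, -p026 (-x2.png)` by this seat (2026-08-21).

CITATION HEADER (lean-in-tree rule).  WHAT IS REPRODUCED: the existence half of the sentences *"Let us denote by 𝒢 a
covariance of the Gaussian integral on the right-hand side above"* ((2.25)–(2.26) p. 226), *"a covariance C^{(j)}_Λ of
the last Gaussian integrals in (2.106) is a bounded operator"* ((2.110) p. 242), *"Let us denote a covariance of this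
Gaussian integral by G̃_j"* ((2.115) p. 243) and *"a covariance C̃^{(j)}_Λ of the Gaussian integral in (2.119) is
bounded from above"* (p. 246), in the ONE typed convention under which the lit-balaban files `…B6Eq295` §4 (r03),
`…B6GaussianIdentity2119`, `…B6Eq2130`, `…B6Repr2129`, `…B6Eq2144` (this seat) PROVE (2.24)–(2.25), (2.113)–(2.116),
(2.119), (2.129), (2.145)–(2.147): a δ-function Gaussian integral is an integral over a linear parametrisation
`ι : N → X` of the constraint configurations, and *"a covariance"* of `∫ e^{−½⟨x,Mx⟩+⟨x,K⟩}` over `ι(N)` is an operator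
`C = ι∘T` (ranging in the constraint configurations) with `⟨ιm, M(CK)⟩ = ⟨ιm, K⟩` — in all those files `C`, `T` and
this identity are DATA/HYPOTHESES (`hGt`/`hsol`, `hCt`/`hCsol`, `hCp`/`hsol`).  HERE: such a `C` EXISTS as soon as the
form is coercive on the constraint configurations (`exists_covariance`; print: positivity (2.11), (2.110), p. 246
*"These forms are bounded from below by γ₀″‖B‖²"*), it is UNIQUE (`cov_unique`) and SYMMETRIC for symmetric `M`
(`cov_symm`), and it obeys the p. 246 bound (`exists_covariance_bounded`, by `…B6Repr2129.norm_cov_le`) — so the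
covariance hypotheses of the files above are satisfiable and determine their object, on every finite-dimensional
configuration space (the lattice spaces of the paper are finite-dimensional).  Companion, not duplicate, of
`…B6SectA.covariance_unique` (r03; uniqueness in the (2.27)-specific convention *"T maps into N(Q′), is symmetric,
T(Δ′²λ) = λ"*).  PHASE-2 seat p22 (gen 3); owner r03, referee ref-4.  Nothing of any existing module is restated or
modified; `…B6Repr2129.norm_cov_le`/`cov_coercive` are consumed by name.

PRINT (verbatim).  p. 226: *"e^{½⟨f,Rf⟩} = Z′⁻¹∫dλ δ(Q′λ) e^{−½‖Δλ‖² + ⟨Δf,λ⟩}. (2.25) Let us denote by 𝒢 a covariance of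
the Gaussian integral on the right-hand side above. Thus we have R = Δ𝒢Δ. (2.26) It is easy to see that
𝒢 = G′² − G′²Q′*(Q′G′²Q′*)⁻¹Q′G′². (2.27)"*; p. 242: *"γ₀‖ω‖² ≤ ⟨ω, Δ′_jω⟩ ≤ γ₁‖ω‖² for ω : Q′₁ω = 0, (2.110) with
positive constants γ₀, γ₁ dependent on d and L only. From the theorem on unit lattice operators in [3] it follows that
a covariance C^{(j)}_Λ of the last Gaussian integrals in (2.106) is a bounded operator with an exponential decay
independent of j and Λ."*; p. 243: *"∫dA δ(Q_jA) exp[−½⟨A,(Δ−∂P_j∂*)A⟩ + ⟨A, J − …⟩]. (2.114) Let us denote a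
covariance of this Gaussian integral by G̃_j, then the integral is equal to Z̃_j exp[½⟨J − …, G̃_j(J − …)⟩]. (2.115)"*;
p. 246: *"These forms are bounded from below by γ₀″‖B‖² with a positive constant γ₀″ dependent on d and L only. This
implies that a covariance C̃^{(j)}_Λ of the Gaussian integral in (2.119) is bounded from above by a positive constant
dependent on d and L only"*.

WHAT IS TYPED / PROVED (no deferred proofs; 0 definitions; every hypothesis displayed).
§1 **`exists_covariance`** — `X` a finite-dimensional real inner-product space, `ι : N →ₗ X` any linear
   parametrisation of the constraint configurations `U = ι(N)`, `M : X →ₗ X` with `γ‖u‖² ≤ ⟨u, Mu⟩` on `U`, `γ > 0`: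
   there are `C : X →ₗ X`, `T : X →ₗ N` with `C = ι∘T` and `⟨ιm, M(CK)⟩ = ⟨ιm, K⟩` for all `m`, `K`.  (Proof: compress
   `M` to `U` with the orthogonal projection; the compression is injective by coercivity, hence bijective on the
   finite-dimensional `U`; compose its inverse with the projection and with a linear right inverse of `ι` onto `U`.)
§2 **`cov_unique`** — two such covariances coincide (coercivity); **`cov_symm`** — for symmetric `M` every such
   covariance is symmetric, `⟨CK, K′⟩ = ⟨K, CK′⟩` (the property *"(b) symmetric"* presupposed in
   `…B6SectA.covariance_unique` and `…B6Eq295.eq2111_exponent`'s `hC`).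
§3 **`exists_covariance_bounded`** — existence together with the p. 246 bound `‖CK‖ ≤ γ⁻¹‖K‖`
   (`…B6Repr2129.norm_cov_le`).
READINGS.  (a) "Covariance" of a possibly degenerate parametrisation `ι` (not injective) is read, as in the files
above, at the level of `C = ι∘T` on `X`; `T` itself is then not unique, `C` is (`cov_unique`).  (b) Finite
dimensionality of `X` is the paper's situation (fields on a finite torus); it is used only to invert the compressed
form on `U` and to pick a linear right inverse of `ι`.  (c) `≤`/junk conventions of `…B6Eq295`.
Unit `lit-balaban-p22` (PHASE-2 proof seat, gen 3), HOME `run/shared/lean/pub/lit-balaban/`, 2026-08-21.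
-/

noncomputable section

open scoped InnerProductSpace

namespace Literature.MathematicalPhysics.QuantumFieldTheory.Balaban1983to89.B6GaussianCovariance

/-! ## §1 Existence -/

section Existence

variable {X : Type*} [NormedAddCommGroup X] [InnerProductSpace ℝ X] [FiniteDimensional ℝ X]
variable {N : Type*} [AddCommGroup N] [Module ℝ N]

/-- **A covariance EXISTS** (*"Let us denote a covariance of this Gaussian integral by G̃_j"*, (2.115); likewise 𝒢 of
(2.25), C^{(j)}_Λ of (2.106)/(2.110), C̃^{(j)}_Λ of (2.119)/p. 246) in the typed convention of `…B6Eq295` §4: for a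
form `M` coercive on the constraint configurations `ι(N)` — `γ‖ιm‖² ≤ ⟨ιm, M ιm⟩`, `γ > 0` (positivity (2.11) /
(2.110) / p. 246 *"bounded from below by γ₀″‖B‖²"*) — there are `C = ι∘T` with `⟨ιm, M(CK)⟩ = ⟨ιm, K⟩` for all `m, K`.
[cite: Balaban1984PropagatorsII, (2.25) p.226 + (2.110) p.242 + (2.115) p.243 + p.246] -/
theorem exists_covariance (ι : N →ₗ[ℝ] X) (M : X →ₗ[ℝ] X) (γ : ℝ) (hγ : 0 < γ)
    (hcoer : ∀ m : N, γ * ‖ι m‖ ^ 2 ≤ ⟪ι m, M (ι m)⟫_ℝ) :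
    ∃ (C : X →ₗ[ℝ] X) (T : X →ₗ[ℝ] N), (∀ v, C v = ι (T v)) ∧
      ∀ (m : N) (v : X), ⟪ι m, M (C v)⟫_ℝ = ⟪ι m, v⟫_ℝ := by
  classical
  set U : Submodule ℝ X := LinearMap.range ι with hU
  -- the orthogonal projection onto the constraint configurations, as a linear map
  let S : X →ₗ[ℝ] X := (U.starProjection : X →L[ℝ] X).toLinearMap
  have hSmem : ∀ x, S x ∈ U := fun x => U.starProjection_apply_mem x
  have hSorth : ∀ (u : X), u ∈ U → ∀ x, ⟪u, x⟫_ℝ = ⟪u, S x⟫_ℝ := by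
    intro u hu x
    have h' : ⟪x - S x, u⟫_ℝ = 0 := Submodule.starProjection_inner_eq_zero x u hu
    rw [inner_sub_left, sub_eq_zero] at h'
    rw [real_inner_comm, h', real_inner_comm]
  -- the form compressed to `U`
  let A : U →ₗ[ℝ] U := (S ∘ₗ M ∘ₗ U.subtype).codRestrict U (fun u => hSmem _)
  have hAval : ∀ u : U, (A u : X) = S (M u) := fun u => rfl
  have hcoerU : ∀ u : X, u ∈ U → γ * ‖u‖ ^ 2 ≤ ⟪u, M u⟫_ℝ := by
    intro u hu
    obtain ⟨m, rfl⟩ := LinearMap.mem_range.mp hu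
    exact hcoer m
  -- coercivity ⇒ the compression is injective, hence bijective (finite dimension)
  have hAinj : Function.Injective A := by
    intro u₁ u₂ h
    have h0 : A (u₁ - u₂) = 0 := by rw [map_sub, h, sub_self]
    set w : U := u₁ - u₂ with hw
    have h1 : ⟪(w : X), M w⟫_ℝ = 0 := by
      rw [hSorth w w.2 (M w), ← hAval, h0]
      simp
    have h2 : γ * ‖(w : X)‖ ^ 2 ≤ 0 := (hcoerU w w.2).trans_eq h1
    have h3 : ‖(w : X)‖ ^ 2 ≤ 0 := by nlinarith [sq_nonneg ‖(w : X)‖]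
    have h4 : ‖(w : X)‖ = 0 := by nlinarith [norm_nonneg (w : X)]
    have h5 : (w : X) = 0 := norm_eq_zero.mp h4
    have h6 : w = 0 := by exact_mod_cast h5
    exact sub_eq_zero.mp h6
  let Ae : U ≃ₗ[ℝ] U := LinearEquiv.ofInjectiveEndo A hAinj
  have hAe : ∀ u, Ae u = A u := fun u => rfl
  -- a linear right inverse of `ι` onto its range
  obtain ⟨g, hg⟩ := LinearMap.exists_rightInverse_of_surjective ι.rangeRestrict (LinearMap.range_rangeRestrict ι)
  have hg' : ∀ u : U, ι (g u) = (u : X) := by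
    intro u
    have h := LinearMap.congr_fun hg u
    simp only [LinearMap.coe_comp, Function.comp_apply, LinearMap.id_coe, id_eq] at h
    simpa using congrArg Subtype.val h
  let Sr : X →ₗ[ℝ] U := S.codRestrict U hSmem
  refine ⟨U.subtype ∘ₗ Ae.symm.toLinearMap ∘ₗ Sr, g ∘ₗ Ae.symm.toLinearMap ∘ₗ Sr, ?_, ?_⟩
  · intro v
    simp only [LinearMap.coe_comp, Function.comp_apply, Submodule.coe_subtype, LinearEquiv.coe_coe, hg']
  · intro m v
    have hm : ι m ∈ U := LinearMap.mem_range_self ι m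
    rw [hSorth (ι m) hm]
    simp only [LinearMap.coe_comp, Function.comp_apply, Submodule.coe_subtype, LinearEquiv.coe_coe]
    rw [← hAval, ← hAe, LinearEquiv.apply_symm_apply]
    change ⟪ι m, S v⟫_ℝ = ⟪ι m, v⟫_ℝ
    rw [← hSorth (ι m) hm v]

end Existence

/-! ## §2 Uniqueness and symmetry -/

section UniqueSymm

variable {X : Type*} [NormedAddCommGroup X] [InnerProductSpace ℝ X]
variable {N : Type*} [AddCommGroup N] [Module ℝ N]

/-- **The covariance is UNIQUE** in the typed convention: two operators `C₁ = ι∘T₁`, `C₂ = ι∘T₂` with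
`⟨ιm, M(C_iK)⟩ = ⟨ιm, K⟩` coincide, for `M` coercive on `ι(N)` (so *"a covariance"* = THE covariance; cf.
`…B6SectA.covariance_unique` in the (2.27)-convention). [cite: Balaban1984PropagatorsII, (2.25)–(2.27) pp.226–227 + (2.115) p.243] -/
theorem cov_unique (ι : N →ₗ[ℝ] X) (T₁ T₂ : X →ₗ[ℝ] N) (M C₁ C₂ : X →ₗ[ℝ] X) (γ : ℝ) (hγ : 0 < γ)
    (hcoer : ∀ m : N, γ * ‖ι m‖ ^ 2 ≤ ⟪ι m, M (ι m)⟫_ℝ)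
    (hC₁ : ∀ v, C₁ v = ι (T₁ v)) (hsol₁ : ∀ (m : N) (v : X), ⟪ι m, M (C₁ v)⟫_ℝ = ⟪ι m, v⟫_ℝ)
    (hC₂ : ∀ v, C₂ v = ι (T₂ v)) (hsol₂ : ∀ (m : N) (v : X), ⟪ι m, M (C₂ v)⟫_ℝ = ⟪ι m, v⟫_ℝ) :
    C₁ = C₂ := by
  ext v
  have hd : C₁ v - C₂ v = ι (T₁ v - T₂ v) := by rw [map_sub, hC₁, hC₂]
  have h0 : ⟪ι (T₁ v - T₂ v), M (ι (T₁ v - T₂ v))⟫_ℝ = 0 := by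
    have e : M (ι (T₁ v - T₂ v)) = M (C₁ v) - M (C₂ v) := by rw [← hd, map_sub]
    rw [e, inner_sub_right, hsol₁, hsol₂, sub_self]
  have h1 : γ * ‖ι (T₁ v - T₂ v)‖ ^ 2 ≤ 0 := (hcoer _).trans_eq h0
  have h2 : ‖ι (T₁ v - T₂ v)‖ ^ 2 ≤ 0 := by nlinarith [sq_nonneg ‖ι (T₁ v - T₂ v)‖]
  have h3 : ‖ι (T₁ v - T₂ v)‖ = 0 := by nlinarith [norm_nonneg (ι (T₁ v - T₂ v))]
  rw [← sub_eq_zero, hd]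
  exact norm_eq_zero.mp h3

/-- **The covariance is SYMMETRIC** for a symmetric form `M`: `⟨CK, K′⟩ = ⟨K, CK′⟩` — the property presupposed in
`…B6SectA.covariance_unique` (b) and in `…B6Eq295.eq2111_exponent` (`hC`), PROVED in the typed convention (no
coercivity needed). [cite: Balaban1984PropagatorsII, (2.27) p.227 + (2.111) p.242] -/
theorem cov_symm (ι : N →ₗ[ℝ] X) (T : X →ₗ[ℝ] N) (M C : X →ₗ[ℝ] X)
    (hM : ∀ x y : X, ⟪M x, y⟫_ℝ = ⟪x, M y⟫_ℝ) (hC : ∀ v, C v = ι (T v))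
    (hsol : ∀ (m : N) (v : X), ⟪ι m, M (C v)⟫_ℝ = ⟪ι m, v⟫_ℝ) (K K' : X) :
    ⟪C K, K'⟫_ℝ = ⟪K, C K'⟫_ℝ := by
  -- ⟨CK, K′⟩ = ⟨CK, M(CK′)⟩ and ⟨K, CK′⟩ = ⟨CK′, K⟩ = ⟨CK′, M(CK)⟩ = ⟨M(CK′), CK⟩ = ⟨CK, M(CK′)⟩
  have h1 : ⟪C K, K'⟫_ℝ = ⟪C K, M (C K')⟫_ℝ := by
    have h := hsol (T K) K'
    rw [← hC] at h
    exact h.symm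
  have h2 : ⟪C K', K⟫_ℝ = ⟪C K', M (C K)⟫_ℝ := by
    have h := hsol (T K') K
    rw [← hC] at h
    exact h.symm
  rw [h1, real_inner_comm (C K') K, h2, ← hM, real_inner_comm]

end UniqueSymm

/-! ## §3 Existence with the bound of p. 246 -/

section Bounded

variable {X : Type*} [NormedAddCommGroup X] [InnerProductSpace ℝ X] [FiniteDimensional ℝ X]
variable {N : Type*} [AddCommGroup N] [Module ℝ N]

/-- **p. 246: the covariance exists AND *"is bounded from above by"* `γ⁻¹`** (`γ` the lower bound of the form on the
constraint configurations): `∃ C = ι∘T`, `⟨ιm, M(CK)⟩ = ⟨ιm, K⟩`, `‖CK‖ ≤ γ⁻¹‖K‖` (`…B6Repr2129.norm_cov_le`).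
[cite: Balaban1984PropagatorsII, p.246 + (2.110) p.242] -/
theorem exists_covariance_bounded (ι : N →ₗ[ℝ] X) (M : X →ₗ[ℝ] X) (γ : ℝ) (hγ : 0 < γ)
    (hcoer : ∀ m : N, γ * ‖ι m‖ ^ 2 ≤ ⟪ι m, M (ι m)⟫_ℝ) :
    ∃ (C : X →ₗ[ℝ] X) (T : X →ₗ[ℝ] N), (∀ v, C v = ι (T v)) ∧
      (∀ (m : N) (v : X), ⟪ι m, M (C v)⟫_ℝ = ⟪ι m, v⟫_ℝ) ∧ ∀ K, ‖C K‖ ≤ γ⁻¹ * ‖K‖ := by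
  obtain ⟨C, T, hC, hsol⟩ := exists_covariance ι M γ hγ hcoer
  exact ⟨C, T, hC, hsol, B6Repr2129.norm_cov_le ι T M C γ hγ hcoer hC hsol⟩

end Bounded

end Literature.MathematicalPhysics.QuantumFieldTheory.Balaban1983to89.B6GaussianCovariance

end
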